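import Literature.Analysis.FluidPDE.TransportGalerkinScheme
import Literature.Analysis.FunctionSpaces.DiagonalWeakLimits
import Literature.Analysis.FunctionSpaces.TorusSpaceTimeFields
import Literature.Analysis.FunctionSpaces.TorusWeakNull
import HarnessLib

/-!
# The Fourier–Galerkin scheme for the linear transport equation on `T^d`, III: diagonal
  extraction, the limit field, weak convergence of the slices, weak continuity in time

Analysis/FluidPDE proof-support file, third of the discharge of
`Torus.BardosTitiWiedemann2012_transportExistence` (`TransportWeakExistence`; Bardos–Titi–Wiedemann
2012, proof of Cor. 2; DiPerna–Lions 1989, Prop. II.1) for velocities weakly continuous into `L²`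
(`TransportGalerkin`, `TransportGalerkinScheme` for the scheme `W_N` and its equi-Lipschitz Fourier
coefficients). Here the compactness step of Hopf's method is carried out for the scalar transport
equation (Hopf 1951, §4; Robinson–Rodrigo–Sadowski 2016, Thm. 4.11, Exercises 4.3–4.5 and Cor. 6.36 of
Ożański–Pooley 2018 for the weak continuity of the limit):

* **diagonal extraction** (`exists_subseq_tendsto_galerkinCoeffAt`): along a subsequence `φ` the
  coefficients `𝓕(W_{φ n}(t))(k)` converge for every `k ∈ ℤ^d` and every `t ≥ 0` — Tychonoff over
  the countable family indexed by frequencies and nonnegative rational times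
  (`Literature.Analysis.FunctionSpaces.exists_strictMono_forall_tendsto`), then all times by the equi-Lipschitz
  estimate (`forall_exists_tendsto_of_subset_closure`); the limits `c t k` keep the finite energy
  bounds `∑_{k∈F} ‖c t k‖² ≤ ∫ w₀²`, the Lipschitz continuity in `t` and conjugate symmetry;
* **the limit field** (`exists_limitField`, `IsGalerkinLimit`, `exists_isGalerkinLimit`): a real
  field `w`, jointly measurable on `(0,∞) × T^d`, with `w(t) ∈ L²` and `𝓕(w(t)) = c(t)` for *every*
  `t ≥ 0` (the parametrised Riesz–Fischer theorem of `TorusSpaceTimeFields`, applied to the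
  coefficients embedded along one coordinate of `ℂ^d`; positive dimension);
* **the `L²` bound** `∫ w(t)² ≤ ∫ w₀²` (`IsGalerkinLimit.integral_sq_le`, Parseval);
* **weak convergence of the slices** `∫ W_{φ n}(t) g → ∫ w(t) g` for all `g ∈ L²(T^d)`, `t ≥ 0`
  (`IsGalerkinLimit.tendsto_integral_mul`, via `Torus.tendsto_integral_mul_of_tendsto_mFourierCoeff`);
* **weak continuity in time** of the limit, `t ↦ ∫ w(t) g` continuous on `[0, ∞)` for every
  `g ∈ L²` (`IsGalerkinLimit.continuousOn_integral_mul`: explicit against trigonometric polynomials,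
  `integral_mul_reTrigPoly`, and uniform approximation with the weighted Cauchy–Schwarz bound
  `abs_integral_mul_le_weighted` and `P_M g → g` in `L²`).

The passage to the limit in the weak formulation is the subject of the sequel.

## References

* C. Bardos, E. S. Titi, E. Wiedemann, C. R. Math. Acad. Sci. Paris 350 (2012) 757–760, proof of
  Cor. 2 (`BardosTitiWiedemann2012`).
* R. J. DiPerna, P.-L. Lions, Invent. Math. 98 (1989) 511–547, Prop. II.1 (`DiPernaLions1989Invent`).
* J. C. Robinson, J. L. Rodrigo, W. Sadowski, *The three-dimensional Navier–Stokes equations*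
  (CUP 2016), Thm. 4.11, Exercises 4.3–4.5 (`RobinsonRodrigoSadowski2016`).
* W. S. Ożański, B. C. Pooley, in LMS Lecture Note Ser. 452 (CUP 2018), proof of Thm. 6.37, Step 1,
  and Cor. 6.36 (`OzanskiPooley2018`).
-/

open MeasureTheory Set Filter Topology Function UnitAddTorus Metric
open scoped ENNReal NNReal InnerProductSpace ComplexConjugate

noncomputable section

namespace Literature.Analysis.FluidPDE

namespace Torus

open Literature.Analysis.FunctionSpaces.Torus Literature.Analysis.FunctionSpaces

variable {d : Type*} [Fintype d] [DecidableEq d]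
variable {b : ℝ → UnitAddTorus d → EuclideanSpace ℝ d} {B : ℝ} {w₀ : UnitAddTorus d → ℝ}

/-! ## Finite energy bounds for the extended coefficients -/

section Energy

/-- Finite sums of squared Fourier coefficients of the approximation are bounded by `∫ w₀²`. [folklore] -/
theorem sum_norm_galerkinCoeffAt_sq_le (hb : GalerkinVelocity b B) (hw₀ : MemLp w₀ 2 volume) (N : ℕ)
    {t : ℝ} (ht : 0 ≤ t) (F : Finset (d → ℤ)) :
    ∑ k ∈ F, ‖galerkinCoeffAt hb w₀ N t k‖ ^ 2 ≤ ∫ x, w₀ x ^ 2 := by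
  classical
  obtain ⟨-, -, -, hcons⟩ := galerkinCoeff_spec hb w₀ N
  -- split off the frequencies outside the ball, where the coefficients vanish
  have h1 : ∑ k ∈ F, ‖galerkinCoeffAt hb w₀ N t k‖ ^ 2 =
      ∑ k ∈ F ∩ freqBall N, ‖galerkinCoeffAt hb w₀ N t k‖ ^ 2 := by
    rw [← Finset.sum_inter_add_sum_sdiff F (freqBall N) fun k => ‖galerkinCoeffAt hb w₀ N t k‖ ^ 2]
    conv_rhs => rw [← add_zero (∑ k ∈ F ∩ freqBall N, ‖galerkinCoeffAt hb w₀ N t k‖ ^ 2)]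
    congr 1
    refine Finset.sum_eq_zero fun k hk => ?_
    rw [Finset.mem_sdiff] at hk
    rw [galerkinCoeffAt, scalarCoeffExt_of_not_mem _ hk.2, norm_zero, zero_pow two_ne_zero]
  have h2 : ∑ k ∈ F ∩ freqBall N, ‖galerkinCoeffAt hb w₀ N t k‖ ^ 2 ≤
      ∑ k ∈ freqBall N, ‖galerkinCoeffAt hb w₀ N t k‖ ^ 2 :=
    Finset.sum_le_sum_of_subset_of_nonneg Finset.inter_subset_right fun _ _ _ => sq_nonneg _
  have h3 : ∑ k ∈ freqBall N, ‖galerkinCoeffAt hb w₀ N t k‖ ^ 2 = ∑ k, ‖galerkinCoeff hb w₀ N t k‖ ^ 2 :=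
    sum_scalarCoeffExt (fun _ z => ‖z‖ ^ 2) (galerkinCoeff hb w₀ N t)
  rw [h1]
  refine h2.trans ?_
  rw [h3, hcons t ht]
  exact sum_norm_sq_truncCoeff_le N hw₀

/-- `‖𝓕(W_N(t))(k)‖ ≤ (∫ w₀²)^{1/2}`. [folklore] -/
theorem norm_galerkinCoeffAt_le_sqrt (hb : GalerkinVelocity b B) (hw₀ : MemLp w₀ 2 volume) (N : ℕ)
    {t : ℝ} (ht : 0 ≤ t) (k : d → ℤ) : ‖galerkinCoeffAt hb w₀ N t k‖ ≤ Real.sqrt (∫ x, w₀ x ^ 2) := by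
  rw [← Real.sqrt_sq (norm_nonneg _)]
  exact Real.sqrt_le_sqrt (norm_galerkinCoeffAt_sq_le hb hw₀ N ht k)

end Energy

/-! ## Diagonal extraction: convergence of all Fourier coefficients at all times -/

section Extraction

/-- The equi-Lipschitz constant of the `k`-th coefficient. [folklore] -/
def coeffLip (w₀ : UnitAddTorus d → ℝ) (B : ℝ) (k : d → ℤ) : ℝ :=
  Real.pi * freqWeight k * ((∫ x, w₀ x ^ 2) + B)

/-- Nonnegative rationals, cast to `ℝ`, are dense in `[0, ∞)`. [folklore] -/
theorem Ici_subset_closure_nonneg_rat :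
    (Ici (0 : ℝ)) ⊆ closure {t : ℝ | ∃ q : ℚ, (0 : ℝ) ≤ q ∧ t = q} := by
  intro t ht
  refine Metric.mem_closure_iff.2 fun ε hε => ?_
  obtain ⟨q, hq1, hq2⟩ := exists_rat_btwn (show t < t + ε by linarith)
  refine ⟨q, ⟨q, (mem_Ici.1 ht).trans hq1.le, rfl⟩, ?_⟩
  rw [Real.dist_eq, abs_lt]
  constructor <;> linarith

/-- **Diagonal extraction.** Along a subsequence `φ`, the Fourier coefficients `𝓕(W_{φ n}(t))(k)`
of the Galerkin approximations converge for every frequency `k` and every time `t ≥ 0`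
(countably many bounded sequences at the nonnegative rational times, Tychonoff; then all times by
the equi-Lipschitz estimate), to limits `c t k` inheriting the bound `‖c t k‖² ≤ ∫ w₀²`, the
finite energy bounds, the Lipschitz continuity in time and conjugate symmetry (Hopf 1951, §4;
Robinson–Rodrigo–Sadowski 2016, Thm. 4.11 and Exercises 4.3–4.4). [folklore] -/
theorem exists_subseq_tendsto_galerkinCoeffAt (hb : GalerkinVelocity b B) (hw₀ : MemLp w₀ 2 volume) :
    ∃ φ : ℕ → ℕ, StrictMono φ ∧ ∃ c : ℝ → (d → ℤ) → ℂ,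
      (∀ t, 0 ≤ t → ∀ k, Tendsto (fun n => galerkinCoeffAt hb w₀ (φ n) t k) atTop (𝓝 (c t k))) ∧
      (∀ t, 0 ≤ t → ∀ F : Finset (d → ℤ), ∑ k ∈ F, ‖c t k‖ ^ 2 ≤ ∫ x, w₀ x ^ 2) ∧
      (∀ k s t, 0 ≤ s → 0 ≤ t → ‖c t k - c s k‖ ≤ coeffLip w₀ B k * |t - s|) ∧
      (∀ t, 0 ≤ t → ∀ k, c t (-k) = conj (c t k)) := by
  classical
  -- Step 1: the diagonal subsequence at nonnegative rational times
  set ι := (d → ℤ) × {q : ℚ // (0 : ℝ) ≤ q} with hι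
  set x : ℕ → ι → ℂ := fun N p => galerkinCoeffAt hb w₀ N ((p.2 : ℚ) : ℝ) p.1 with hx
  have hxb : ∀ p : ι, ∃ (z : ℂ) (R : ℝ), ∀ N, x N p ∈ closedBall z R := fun p =>
    ⟨0, Real.sqrt (∫ x, w₀ x ^ 2), fun N => by
      rw [mem_closedBall, dist_zero_right]
      exact norm_galerkinCoeffAt_le_sqrt hb hw₀ N p.2.2 p.1⟩
  obtain ⟨φ, hφ, hlimq⟩ := exists_strictMono_forall_tendsto x hxb
  -- Step 2: convergence at every `t ≥ 0`, frequency by frequency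
  have hall : ∀ k, ∀ t ∈ Ici (0 : ℝ), ∃ l, Tendsto (fun n => galerkinCoeffAt hb w₀ (φ n) t k) atTop (𝓝 l) := by
    intro k
    refine forall_exists_tendsto_of_subset_closure (x := fun n t => galerkinCoeffAt hb w₀ (φ n) t k)
      Ici_subset_closure_nonneg_rat ?_ ?_
    · rintro _ ⟨q, hq, rfl⟩
      exact hlimq (k, ⟨q, hq⟩)
    · intro ε hε
      have hL : 0 ≤ coeffLip w₀ B k := mul_nonneg (mul_nonneg Real.pi_pos.le (freqWeight_nonneg k))
        (add_nonneg (integral_nonneg fun x => sq_nonneg _) hb.nonneg)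
      refine ⟨ε / (coeffLip w₀ B k + 1), by positivity, fun n t ht s hs hts => ?_⟩
      obtain ⟨q, hq, rfl⟩ := hs
      rw [dist_eq_norm]
      have hmax_t : t ∈ Icc 0 (max t q) := ⟨ht, le_max_left _ _⟩
      have hmax_q : (q : ℝ) ∈ Icc 0 (max t q) := ⟨hq, le_max_right _ _⟩
      calc ‖galerkinCoeffAt hb w₀ (φ n) t k - galerkinCoeffAt hb w₀ (φ n) q k‖
          ≤ coeffLip w₀ B k * |t - q| := norm_galerkinCoeffAt_sub_le hb hw₀ (φ n) hmax_q hmax_t k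
        _ < coeffLip w₀ B k * (ε / (coeffLip w₀ B k + 1)) + 1 * (ε / (coeffLip w₀ B k + 1)) := by
            have h1 : |t - q| < ε / (coeffLip w₀ B k + 1) := by rwa [← Real.dist_eq]
            nlinarith [mul_le_mul_of_nonneg_left h1.le hL, abs_nonneg (t - q)]
        _ = ε := by field_simp
  -- Step 3: the limits and their properties
  choose! c hc using hall
  refine ⟨φ, hφ, fun t k => c k t, fun t ht k => hc k t ht, ?_, ?_, ?_⟩
  · intro t ht F
    have hF : Tendsto (fun n => ∑ k ∈ F, ‖galerkinCoeffAt hb w₀ (φ n) t k‖ ^ 2) atTop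
        (𝓝 (∑ k ∈ F, ‖c k t‖ ^ 2)) :=
      tendsto_finsetSum F fun k _ => ((hc k t ht).norm).pow 2
    exact le_of_tendsto hF (Eventually.of_forall fun n => sum_norm_galerkinCoeffAt_sq_le hb hw₀ (φ n) ht F)
  · intro k s t hs ht
    have h := dist_lim_le_of_dist_le (hc k t ht) (hc k s hs) fun n => by
      rw [dist_eq_norm]
      exact norm_galerkinCoeffAt_sub_le hb hw₀ (φ n) (T := max s t) ⟨hs, le_max_left _ _⟩ ⟨ht, le_max_right _ _⟩ k
    rwa [dist_eq_norm] at h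
  · intro t ht k
    have h1 : Tendsto (fun n => galerkinCoeffAt hb w₀ (φ n) t (-k)) atTop (𝓝 (conj (c k t))) := by
      have h := (Complex.continuous_conj.tendsto (c k t)).comp (hc k t ht)
      refine h.congr fun n => ?_
      simp only [Function.comp_apply, galerkinCoeffAt_neg]
    exact tendsto_nhds_unique (hc (-k) t ht) h1

end Extraction

/-! ## The limit field: `L²` slices with the limiting Fourier coefficients, for every time -/

section LimitField

variable [Nonempty d]

/-- Embedding a scalar coefficient family into `ℂ^d` along a fixed coordinate. [folklore] -/
def embedCoeff (c : ℝ → (d → ℤ) → ℂ) : ℝ → (d → ℤ) → EuclideanSpace ℂ d :=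
  fun t k => c t k • EuclideanSpace.single (Classical.arbitrary d) (1 : ℂ)

/-- Norms are preserved by the embedding. [folklore] -/
theorem norm_embedCoeff (c : ℝ → (d → ℤ) → ℂ) (t : ℝ) (k : d → ℤ) : ‖embedCoeff c t k‖ = ‖c t k‖ := by
  rw [embedCoeff, norm_smul, PiLp.norm_single, norm_one, mul_one]

omit [Fintype d] in
/-- The embedding of a conjugate-symmetric family is conjugate symmetric. [folklore] -/
theorem isConjSymm_embedCoeff {c : ℝ → (d → ℤ) → ℂ} {t : ℝ} (hc : ∀ k, c t (-k) = conj (c t k)) :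
    IsConjSymm (embedCoeff c t) := by
  intro k
  rw [embedCoeff, embedCoeff, hc k, EuclideanSpace.conjVec_smul]
  congr 1
  ext i
  simp [EuclideanSpace.conjVec_apply, PiLp.single_apply]

/-- **The limit field.** From the diagonal subsequence of `exists_subseq_tendsto_galerkinCoeffAt`:
a real field `w : ℝ → T^d → ℝ`, jointly measurable on `(0,∞) × ℝ^d` through its space–time lift,
with `w t ∈ L²` and `𝓕(w t) = c t` (the limiting coefficients) for **every** `t ≥ 0`
(`TorusSpaceTimeFields.exists_realField_forall_mFourierCoeff_eq` applied to the coefficients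
embedded along one coordinate of `ℂ^d`). [folklore] -/
theorem exists_limitField (hb : GalerkinVelocity b B) (hw₀ : MemLp w₀ 2 volume) :
    ∃ φ : ℕ → ℕ, StrictMono φ ∧ ∃ c : ℝ → (d → ℤ) → ℂ, ∃ w : ℝ → UnitAddTorus d → ℝ,
      (∀ t, 0 ≤ t → ∀ k, Tendsto (fun n => galerkinCoeffAt hb w₀ (φ n) t k) atTop (𝓝 (c t k))) ∧
      (∀ t, 0 ≤ t → ∀ F : Finset (d → ℤ), ∑ k ∈ F, ‖c t k‖ ^ 2 ≤ ∫ x, w₀ x ^ 2) ∧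
      (∀ k s t, 0 ≤ s → 0 ≤ t → ‖c t k - c s k‖ ≤ coeffLip w₀ B k * |t - s|) ∧
      AEStronglyMeasurable (stLift w) (volume.restrict (Ioi 0 ×ˢ univ)) ∧
      (∀ t, 0 ≤ t → MemLp (w t) 2 volume ∧ ∀ k, mFourierCoeff (fun x => ((w t x : ℝ) : ℂ)) k = c t k) := by
  obtain ⟨φ, hφ, c, hconv, hsum, hlip, hsymm⟩ := exists_subseq_tendsto_galerkinCoeffAt hb hw₀
  -- hypotheses of the parametrised Riesz–Fischer theorem for the embedded coefficients
  have hmeas : ∀ k, AEStronglyMeasurable (fun t => embedCoeff c t k) (volume.restrict (Ioi 0)) := by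
    intro k
    have hL : LipschitzOnWith (Real.toNNReal (coeffLip w₀ B k)) (fun t => c t k) (Ici 0) := by
      refine LipschitzOnWith.of_dist_le_mul fun t ht s hs => ?_
      rw [dist_eq_norm, Real.dist_eq]
      exact (hlip k s t hs ht).trans (mul_le_mul_of_nonneg_right (Real.le_coe_toNNReal _) (abs_nonneg _))
    have hc : ContinuousOn (fun t => embedCoeff c t k) (Ioi 0) :=
      (hL.continuousOn.mono Ioi_subset_Ici_self).smul continuousOn_const
    exact hc.aestronglyMeasurable measurableSet_Ioi
  have hbound : ∀ T : ℝ, ∃ K : ℝ≥0∞, K ≠ ⊤ ∧ ∀ t ∈ Icc 0 T, ∑' k, ‖embedCoeff c t k‖ₑ ^ 2 ≤ K := by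
    intro T
    refine ⟨ENNReal.ofReal (∫ x, w₀ x ^ 2), ENNReal.ofReal_ne_top, fun t ht => ?_⟩
    refine ENNReal.summable.tsum_le_of_sum_le fun F => ?_
    have h1 : ∑ k ∈ F, ‖embedCoeff c t k‖ₑ ^ 2 = ENNReal.ofReal (∑ k ∈ F, ‖c t k‖ ^ 2) := by
      rw [ENNReal.ofReal_sum_of_nonneg fun k _ => sq_nonneg _]
      refine Finset.sum_congr rfl fun k _ => ?_
      rw [← ofReal_norm, norm_embedCoeff, ENNReal.ofReal_pow (norm_nonneg _)]
    rw [h1]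
    exact ENNReal.ofReal_le_ofReal (hsum t ht.1 F)
  obtain ⟨u, hum, hu⟩ := exists_realField_forall_mFourierCoeff_eq hmeas hbound
    fun t ht => isConjSymm_embedCoeff (hsymm t ht)
  -- the scalar field is the distinguished coordinate of `u`
  set i₀ : d := Classical.arbitrary d with hi₀
  refine ⟨φ, hφ, c, fun t x => u t x i₀, hconv, hsum, hlip, ?_, fun t ht => ⟨?_, fun k => ?_⟩⟩
  · exact (EuclideanSpace.proj i₀ : EuclideanSpace ℝ d →L[ℝ] ℝ).continuous.comp_aestronglyMeasurable hum
  · exact (EuclideanSpace.proj i₀ : EuclideanSpace ℝ d →L[ℝ] ℝ).comp_memLp' (hu t ht).1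
  · have h := congrArg (fun v : EuclideanSpace ℂ d => v i₀) ((hu t ht).2 k)
    have hint : Integrable (EuclideanSpace.complexify ∘ u t) volume :=
      EuclideanSpace.complexify.toContinuousLinearMap.integrable_comp ((hu t ht).1.integrable one_le_two)
    simp only [mFourierCoeff_apply_euclidean hint, Function.comp_apply, EuclideanSpace.complexify_apply,
      embedCoeff, PiLp.smul_apply, smul_eq_mul] at h
    simpa [hi₀] using h

end LimitField

/-! ## Properties of Galerkin limits: `L²` bound, weak convergence of the slices, weak continuity -/

section LimitProps

/-- **A Galerkin limit**: a subsequence `φ`, coefficient limits `c` and a field `w` with the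
properties delivered by `exists_limitField`. [folklore] -/
structure IsGalerkinLimit (hb : GalerkinVelocity b B) (hw₀ : MemLp w₀ 2 volume) (φ : ℕ → ℕ)
    (c : ℝ → (d → ℤ) → ℂ) (w : ℝ → UnitAddTorus d → ℝ) : Prop where
  strictMono : StrictMono φ
  tendsto_coeff : ∀ t, 0 ≤ t → ∀ k, Tendsto (fun n => galerkinCoeffAt hb w₀ (φ n) t k) atTop (𝓝 (c t k))
  sum_sq_le : ∀ t, 0 ≤ t → ∀ F : Finset (d → ℤ), ∑ k ∈ F, ‖c t k‖ ^ 2 ≤ ∫ x, w₀ x ^ 2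
  lip : ∀ k s t, 0 ≤ s → 0 ≤ t → ‖c t k - c s k‖ ≤ coeffLip w₀ B k * |t - s|
  aestronglyMeasurable : AEStronglyMeasurable (stLift w) (volume.restrict (Ioi 0 ×ˢ univ))
  memLp : ∀ t, 0 ≤ t → MemLp (w t) 2 volume
  coeff_eq : ∀ t, 0 ≤ t → ∀ k, mFourierCoeff (fun x => ((w t x : ℝ) : ℂ)) k = c t k

/-- Galerkin limits exist (in positive dimension). [folklore] -/
theorem exists_isGalerkinLimit [Nonempty d] (hb : GalerkinVelocity b B) (hw₀ : MemLp w₀ 2 volume) :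
    ∃ φ c w, IsGalerkinLimit hb hw₀ φ c w := by
  obtain ⟨φ, hφ, c, w, h1, h2, h3, h4, h5⟩ := exists_limitField hb hw₀
  exact ⟨φ, c, w, ⟨hφ, h1, h2, h3, h4, fun t ht => (h5 t ht).1, fun t ht => (h5 t ht).2⟩⟩

namespace IsGalerkinLimit

variable {hb : GalerkinVelocity b B} {hw₀ : MemLp w₀ 2 volume} {φ : ℕ → ℕ} {c : ℝ → (d → ℤ) → ℂ}
  {w : ℝ → UnitAddTorus d → ℝ}

/-- **`L²` bound of the limit**: `∫ w(t)² ≤ ∫ w₀²` for `t ≥ 0` (Parseval and the finite energy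
bounds of the limiting coefficients). [folklore] -/
theorem integral_sq_le (h : IsGalerkinLimit hb hw₀ φ c w) {t : ℝ} (ht : 0 ≤ t) :
    ∫ x, w t x ^ 2 ≤ ∫ x, w₀ x ^ 2 := by
  have hP := hasSum_sq_norm_mFourierCoeff_ofReal (h.memLp t ht)
  simp_rw [h.coeff_eq t ht] at hP
  rw [← hP.tsum_eq]
  exact hP.summable.tsum_le_of_sum_le (h.sum_sq_le t ht)

/-- **Weak convergence of the slices**: `∫ W_{φ n}(t) g → ∫ w(t) g` for every `g ∈ L²(T^d)` and
`t ≥ 0` (the differences are bounded in `L²` with all Fourier coefficients tending to zero;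
`Torus.tendsto_integral_mul_of_tendsto_mFourierCoeff`). [folklore] -/
theorem tendsto_integral_mul (h : IsGalerkinLimit hb hw₀ φ c w) {t : ℝ} (ht : 0 ≤ t)
    {g : UnitAddTorus d → ℝ} (hg : MemLp g 2 volume) :
    Tendsto (fun n => ∫ x, galerkinApprox hb w₀ (φ n) t x * g x) atTop (𝓝 (∫ x, w t x * g x)) := by
  have hW : ∀ n, MemLp (galerkinApprox hb w₀ (φ n) t) 2 volume := fun n => memLp_reTrigPoly _ _ 2
  have hr : ∀ n, MemLp (fun x => galerkinApprox hb w₀ (φ n) t x - w t x) 2 volume := fun n =>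
    (hW n).sub (h.memLp t ht)
  -- uniform `L²` bound of the differences
  have hrM : ∀ n, ∫ x, (galerkinApprox hb w₀ (φ n) t x - w t x) ^ 2 ≤ 4 * ∫ x, w₀ x ^ 2 := by
    intro n
    have h2W : Integrable (fun x => galerkinApprox hb w₀ (φ n) t x ^ 2) volume := by
      simpa using (hW n).integrable_norm_pow two_ne_zero
    have h2w : Integrable (fun x => w t x ^ 2) volume := by
      simpa using (h.memLp t ht).integrable_norm_pow two_ne_zero
    have h2r : Integrable (fun x => (galerkinApprox hb w₀ (φ n) t x - w t x) ^ 2) volume := by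
      simpa using (hr n).integrable_norm_pow two_ne_zero
    calc ∫ x, (galerkinApprox hb w₀ (φ n) t x - w t x) ^ 2
        ≤ ∫ x, (2 * galerkinApprox hb w₀ (φ n) t x ^ 2 + 2 * w t x ^ 2) := by
          refine integral_mono h2r ((h2W.const_mul 2).add (h2w.const_mul 2)) fun x => ?_
          nlinarith [sq_nonneg (galerkinApprox hb w₀ (φ n) t x + w t x)]
      _ = (2 * ∫ x, galerkinApprox hb w₀ (φ n) t x ^ 2) + 2 * ∫ x, w t x ^ 2 := by
          rw [integral_add (h2W.const_mul 2) (h2w.const_mul 2), integral_const_mul, integral_const_mul]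
      _ ≤ (2 * ∫ x, w₀ x ^ 2) + 2 * ∫ x, w₀ x ^ 2 :=
          add_le_add (mul_le_mul_of_nonneg_left (integral_sq_galerkinApprox_le hb hw₀ (φ n) ht) zero_le_two)
            (mul_le_mul_of_nonneg_left (h.integral_sq_le ht) zero_le_two)
      _ = 4 * ∫ x, w₀ x ^ 2 := by ring
  -- the Fourier coefficients of the differences tend to zero
  have hcoef : ∀ k, Tendsto (fun n => mFourierCoeff (fun x => ((galerkinApprox hb w₀ (φ n) t x - w t x : ℝ) : ℂ)) k)
      atTop (𝓝 0) := by
    intro k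
    have hsub : ∀ n, mFourierCoeff (fun x => ((galerkinApprox hb w₀ (φ n) t x - w t x : ℝ) : ℂ)) k =
        galerkinCoeffAt hb w₀ (φ n) t k - c t k := by
      intro n
      have h1 := mFourierCoeff_sub (f := fun x => ((galerkinApprox hb w₀ (φ n) t x : ℝ) : ℂ))
        (g := fun x => ((w t x : ℝ) : ℂ)) ((hW n).integrable one_le_two).ofReal ((h.memLp t ht).integrable one_le_two).ofReal k
      rw [mFourierCoeff_galerkinApprox, h.coeff_eq t ht] at h1
      rw [← h1]
      congr 1
      funext x
      simp only [Pi.sub_apply, Complex.ofReal_sub]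
    simp_rw [hsub]
    have h2 := (h.tendsto_coeff t ht k).sub_const (c t k)
    rwa [sub_self] at h2
  have h0 := tendsto_integral_mul_of_tendsto_mFourierCoeff hr hrM hcoef hg
  -- `∫ (W - w) g = ∫ W g - ∫ w g`
  have hsplit : ∀ n, ∫ x, (galerkinApprox hb w₀ (φ n) t x - w t x) * g x =
      (∫ x, galerkinApprox hb w₀ (φ n) t x * g x) - ∫ x, w t x * g x := by
    intro n
    have i1 : Integrable (fun x => galerkinApprox hb w₀ (φ n) t x * g x) volume := (hW n).integrable_mul hg
    have i2 : Integrable (fun x => w t x * g x) volume := (h.memLp t ht).integrable_mul hg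
    rw [← integral_sub i1 i2]
    refine integral_congr_ae (ae_of_all _ fun x => ?_)
    ring
  simp_rw [hsplit] at h0
  have h3 := h0.add_const (∫ x, w t x * g x)
  simp only [sub_add_cancel, zero_add] at h3
  exact h3

end IsGalerkinLimit

end LimitProps

/-! ## Pairings with trigonometric polynomials, and a Cauchy–Schwarz substitute -/

section PairingTools

omit [DecidableEq d] in
/-- **Pairing a real function with a real trigonometric polynomial** in terms of Fourier
coefficients: `∫ θ · reTrigPoly S a = ∑_{k∈S} Re (a_k 𝓕θ(-k))` (`θ` integrable). [folklore] -/
theorem integral_mul_reTrigPoly {θ : UnitAddTorus d → ℝ} (hθ : Integrable θ volume) (S : Finset (d → ℤ))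
    (a : (d → ℤ) → ℂ) :
    ∫ x, θ x * reTrigPoly S a x = ∑ k ∈ S, (a k * mFourierCoeff (fun x => ((θ x : ℝ) : ℂ)) (-k)).re := by
  have hθC : Integrable (fun x => ((θ x : ℝ) : ℂ)) volume := Complex.ofRealCLM.integrable_comp hθ
  have hint : ∀ k, Integrable (fun x => mFourier k x * ((θ x : ℝ) : ℂ) * a k) volume := by
    intro k
    have h := (integrable_mFourier_smul' hθC (-k)).mul_const (a k)
    refine h.congr (ae_of_all _ fun x => ?_)
    simp only [neg_neg, smul_eq_mul]
  have hpt : ∀ x, θ x * reTrigPoly S a x = ∑ k ∈ S, (mFourier k x * ((θ x : ℝ) : ℂ) * a k).re := by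
    intro x
    rw [reTrigPoly_eq_sum, Finset.mul_sum]
    refine Finset.sum_congr rfl fun k _ => ?_
    rw [← Complex.re_ofReal_mul]
    congr 1
    ring
  simp_rw [hpt]
  rw [integral_finsetSum _ fun k _ => by simpa only [RCLike.re_to_complex] using (hint k).re]
  refine Finset.sum_congr rfl fun k _ => ?_
  have h1 : ∫ x, (mFourier k x * ((θ x : ℝ) : ℂ) * a k).re = (∫ x, mFourier k x * ((θ x : ℝ) : ℂ) * a k).re := by
    have h := integral_re (hint k)
    simpa only [RCLike.re_to_complex] using h
  rw [h1, mFourierCoeff_eq_integral_volume, neg_neg, integral_mul_const]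
  congr 1
  rw [mul_comm]
  simp only [smul_eq_mul]

omit [DecidableEq d] in
/-- **A weighted Cauchy–Schwarz bound**: `|∫ f g| ≤ (δ ∫ f² + δ⁻¹ ∫ g²)/2` for `f, g ∈ L²` and
`δ > 0`. [folklore] -/
theorem abs_integral_mul_le_weighted {f g : UnitAddTorus d → ℝ} (hf : MemLp f 2 volume) (hg : MemLp g 2 volume)
    {δ : ℝ} (hδ : 0 < δ) :
    |∫ x, f x * g x| ≤ (δ * (∫ x, f x ^ 2) + δ⁻¹ * ∫ x, g x ^ 2) / 2 := by
  have hf2 : Integrable (fun x => f x ^ 2) volume := by simpa using hf.integrable_norm_pow two_ne_zero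
  have hg2 : Integrable (fun x => g x ^ 2) volume := by simpa using hg.integrable_norm_pow two_ne_zero
  have hpt : ∀ x, |f x * g x| ≤ (δ * f x ^ 2 + δ⁻¹ * g x ^ 2) / 2 := by
    intro x
    rw [abs_mul]
    have key : 2 * δ * (|f x| * |g x|) ≤ δ ^ 2 * f x ^ 2 + g x ^ 2 := by
      nlinarith [sq_nonneg (δ * |f x| - |g x|), sq_abs (f x), sq_abs (g x)]
    rw [le_div_iff₀ (by norm_num : (0 : ℝ) < 2)]
    have h2 : δ ^ 2 * f x ^ 2 + g x ^ 2 = δ * (δ * f x ^ 2 + δ⁻¹ * g x ^ 2) := by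
      field_simp
    nlinarith [mul_comm (|f x| * |g x|) 2]
  calc |∫ x, f x * g x| ≤ ∫ x, |f x * g x| := abs_integral_le_integral_abs
    _ ≤ ∫ x, (δ * f x ^ 2 + δ⁻¹ * g x ^ 2) / 2 :=
        integral_mono_of_nonneg (ae_of_all _ fun x => abs_nonneg _) (((hf2.const_mul δ).add (hg2.const_mul δ⁻¹)).div_const 2)
          (ae_of_all _ hpt)
    _ = (δ * (∫ x, f x ^ 2) + δ⁻¹ * ∫ x, g x ^ 2) / 2 := by
        rw [integral_div, integral_add (hf2.const_mul δ) (hg2.const_mul δ⁻¹), integral_const_mul, integral_const_mul]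

end PairingTools

/-! ## Weak continuity in time of Galerkin limits -/

section WeakContinuity

namespace IsGalerkinLimit

variable {hb : GalerkinVelocity b B} {hw₀ : MemLp w₀ 2 volume} {φ : ℕ → ℕ} {c : ℝ → (d → ℤ) → ℂ}
  {w : ℝ → UnitAddTorus d → ℝ}

/-- The limiting coefficients are continuous on `[0, ∞)` (indeed Lipschitz). [folklore] -/
theorem continuousOn_coeff (h : IsGalerkinLimit hb hw₀ φ c w) (k : d → ℤ) : ContinuousOn (fun t => c t k) (Ici 0) := by
  have hL : LipschitzOnWith (Real.toNNReal (coeffLip w₀ B k)) (fun t => c t k) (Ici 0) := by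
    refine LipschitzOnWith.of_dist_le_mul fun t ht s hs => ?_
    rw [dist_eq_norm, Real.dist_eq]
    exact (h.lip k s t hs ht).trans (mul_le_mul_of_nonneg_right (Real.le_coe_toNNReal _) (abs_nonneg _))
  exact hL.continuousOn

/-- Pairings of the limit with Fourier truncations are continuous on `[0, ∞)`. [folklore] -/
theorem continuousOn_integral_mul_scalarTruncate (h : IsGalerkinLimit hb hw₀ φ c w) (g : UnitAddTorus d → ℝ) (M : ℕ) :
    ContinuousOn (fun t => ∫ x, w t x * scalarTruncate M g x) (Ici 0) := by
  have hF : ContinuousOn (fun t => ∑ k ∈ freqBall M,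
      (mFourierCoeff (fun x => ((g x : ℝ) : ℂ)) k * c t (-k)).re) (Ici 0) := by
    refine continuousOn_finsetSum _ fun k _ => ?_
    exact Complex.continuous_re.comp_continuousOn (continuousOn_const.mul (h.continuousOn_coeff (-k)))
  refine hF.congr fun t ht => ?_
  show ∫ x, w t x * scalarTruncate M g x = _
  rw [scalarTruncate, integral_mul_reTrigPoly ((h.memLp t ht).integrable one_le_two)]
  refine Finset.sum_congr rfl fun k _ => ?_
  rw [h.coeff_eq t ht]

/-- **Weak continuity in time of Galerkin limits**: `t ↦ ∫ w(t) g` is continuous on `[0, ∞)` for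
every `g ∈ L²(T^d)` (continuous against trigonometric polynomials through the Lipschitz
coefficients; uniform approximation by the uniform `L²` bound `∫ w(t)² ≤ ∫ w₀²` and
`P_M g → g` in `L²`). [folklore] -/
theorem continuousOn_integral_mul (h : IsGalerkinLimit hb hw₀ φ c w) {g : UnitAddTorus d → ℝ} (hg : MemLp g 2 volume) :
    ContinuousOn (fun t => ∫ x, w t x * g x) (Ici 0) := by
  set E : ℝ := ∫ x, w₀ x ^ 2 with hE
  have hE0 : 0 ≤ E := integral_nonneg fun x => sq_nonneg _
  have hunif : TendstoUniformlyOn (fun M t => ∫ x, w t x * scalarTruncate M g x) (fun t => ∫ x, w t x * g x)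
      atTop (Ici 0) := by
    refine Metric.tendstoUniformlyOn_iff.2 fun ε hε => ?_
    set δ : ℝ := ε / (E + 1) with hδ
    have hδ0 : 0 < δ := by positivity
    have hη := tendsto_integral_sq_sub_scalarTruncate hg
    have hev : ∀ᶠ M in atTop, ∫ x, (g x - scalarTruncate M g x) ^ 2 < δ * ε :=
      (tendsto_order.1 hη).2 _ (by positivity)
    filter_upwards [hev] with M hM t ht
    have hgM : MemLp (fun x => g x - scalarTruncate M g x) 2 volume := hg.sub (memLp_scalarTruncate M g 2)
    have hsplit : (∫ x, w t x * g x) - ∫ x, w t x * scalarTruncate M g x = ∫ x, w t x * (g x - scalarTruncate M g x) := by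
      have i1 : Integrable (fun x => w t x * g x) volume := (h.memLp t ht).integrable_mul hg
      have i2 : Integrable (fun x => w t x * scalarTruncate M g x) volume :=
        (h.memLp t ht).integrable_mul (memLp_scalarTruncate M g 2)
      rw [← integral_sub i1 i2]
      refine integral_congr_ae (ae_of_all _ fun x => ?_)
      ring
    rw [Real.dist_eq, hsplit]
    have hb1 := abs_integral_mul_le_weighted (h.memLp t ht) hgM hδ0
    have hw2 : ∫ x, w t x ^ 2 ≤ E := h.integral_sq_le ht
    have h1 : δ * ∫ x, w t x ^ 2 ≤ δ * E := mul_le_mul_of_nonneg_left hw2 hδ0.le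
    have h2 : δ⁻¹ * ∫ x, (g x - scalarTruncate M g x) ^ 2 < δ⁻¹ * (δ * ε) :=
      mul_lt_mul_of_pos_left hM (inv_pos.2 hδ0)
    have h3 : δ⁻¹ * (δ * ε) = ε := by field_simp
    rw [h3] at h2
    have h4 : δ * E < ε := by
      rw [hδ, div_mul_eq_mul_div, div_lt_iff₀ (by positivity)]
      nlinarith
    calc |∫ x, w t x * (g x - scalarTruncate M g x)|
        ≤ (δ * (∫ x, w t x ^ 2) + δ⁻¹ * ∫ x, (g x - scalarTruncate M g x) ^ 2) / 2 := hb1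
      _ < (ε + ε) / 2 := by linarith
      _ = ε := by ring
  exact hunif.continuousOn
    (Eventually.of_forall fun M => h.continuousOn_integral_mul_scalarTruncate g M).frequently

end IsGalerkinLimit

end WeakContinuity

end Torus

end Literature.Analysis.FluidPDE

end
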